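import Mathlib.LinearAlgebra.Dual.Lemmas
import Mathlib.RingTheory.MvPolynomial.Basic
import Mathlib.RingTheory.MvPolynomial.Homogeneous
import Mathlib.LinearAlgebra.Matrix.Permanent
import Literature.Computability.AlgebraicComplexity.StandardFamilies

/-!
# Route LiftNullstellensatz — `LiftWidthPerFour` (item stmt-ValiantsHypothesis-5922): from ABP
layers to ideals of linear forms (bridge lemmas)

Three small facts used to turn the first / last layer of a width-`≤ 5` homogeneous ABP for
`per_4` into the normal form `(x_{i,0}, …, x_{i,3}, ℓ)`:
* `eval_perPoly_eq_permanent` — evaluating the generic permanent at a matrix gives its permanent;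
* `X_mem_span_of_forall_kernel` — duality: if every common zero `v` of the linear forms
  `Σ_x L x k • X x` has `v x₀ = 0`, then `X x₀` lies in their span;
* `exists_extra_generator` — if `≤ 5` linear forms span all `x_{i,j}` (`j < 4`), then they lie in
  the span of `x_{i,0..3}` and ONE further linear form.
No new definitions.
-/

noncomputable section

open MvPolynomial

namespace Summit.ValiantsHypothesis.LiftNullstellensatz

open scoped Literature.Computability.AlgebraicComplexity in
/-- Evaluating the generic permanent `perPoly` at the entries of a matrix gives its permanent.
[folklore] -/
theorem eval_perPoly_eq_permanent {K : Type*} [CommRing K] {n : ℕ}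
    (A : Matrix (Fin n) (Fin n) K) :
    eval (fun x : Fin n × Fin n => A x.1 x.2)
      (Literature.Computability.AlgebraicComplexity.perPoly (Fin n) K) = A.permanent := by
  simp [Literature.Computability.AlgebraicComplexity.perPoly, Matrix.permanent, map_sum, map_prod,
    Matrix.mvPolynomialX]

/-- **Duality for linear forms**: if every common zero `v` of the linear forms
`ℓ_k = Σ_x L x k • X x` satisfies `v x₀ = 0`, then `X x₀ ∈ span_K {ℓ_k}`. [folklore] -/
theorem X_mem_span_of_forall_kernel {K : Type*} [Field K] {σ : Type*} [Fintype σ]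
    [DecidableEq σ] {a : ℕ} (L : σ → Fin a → K) (x₀ : σ)
    (h : ∀ v : σ → K, (∀ k, ∑ x, L x k * v x = 0) → v x₀ = 0) :
    (X x₀ : MvPolynomial σ K) ∈
      Submodule.span K (Set.range fun k => ∑ x, L x k • (X x : MvPolynomial σ K)) := by
  classical
  -- the functionals
  let Lf : Fin a → (σ → K) →ₗ[K] K := fun k => ∑ x, L x k • LinearMap.proj x
  let K₀ : (σ → K) →ₗ[K] K := LinearMap.proj x₀
  have hLf : ∀ k v, Lf k v = ∑ x, L x k * v x := by
    intro k v
    simp only [Lf, LinearMap.coe_sum, Finset.sum_apply, LinearMap.smul_apply,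
      LinearMap.proj_apply, smul_eq_mul]
  have hker : ⨅ k, LinearMap.ker (Lf k) ≤ LinearMap.ker K₀ := by
    intro v hv
    rw [LinearMap.mem_ker]
    refine h v fun k => ?_
    have := (Submodule.mem_iInf _).1 hv k
    rw [LinearMap.mem_ker, hLf] at this
    exact this
  obtain ⟨c, hc⟩ := (Submodule.mem_span_range_iff_exists_fun K).1 (mem_span_of_iInf_ker_le_ker hker)
  -- read off coefficients on the standard basis
  have hcoef : ∀ y : σ, (∑ k, c k * L y k) = if y = x₀ then 1 else 0 := by
    intro y
    have := congrArg (fun f : (σ → K) →ₗ[K] K => f (Pi.single y 1)) hc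
    simp only [LinearMap.coe_sum, Finset.sum_apply, LinearMap.smul_apply, hLf, smul_eq_mul,
      K₀, LinearMap.proj_apply] at this
    simp only [Pi.single_apply] at this
    rw [show (if y = x₀ then (1 : K) else 0) = if x₀ = y then 1 else 0 by
      simp only [eq_comm], ← this]
    refine Finset.sum_congr rfl fun k _ => ?_
    congr 1
    rw [Finset.sum_eq_single y (fun x _ hx => by rw [if_neg hx, mul_zero])
      (fun hy => absurd (Finset.mem_univ y) hy), if_pos rfl, mul_one]
  -- hence `X x₀ = Σ_k c_k ℓ_k`
  have hX : (X x₀ : MvPolynomial σ K) = ∑ k, c k • ∑ x, L x k • (X x : MvPolynomial σ K) := by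
    have : (∑ k, c k • ∑ x, L x k • (X x : MvPolynomial σ K)) =
        ∑ x, (∑ k, c k * L x k) • (X x : MvPolynomial σ K) := by
      simp only [Finset.smul_sum, smul_smul]
      rw [Finset.sum_comm]
      refine Finset.sum_congr rfl fun x _ => ?_
      rw [Finset.sum_smul]
    rw [this]
    simp only [hcoef]
    rw [Finset.sum_eq_single x₀ (fun y _ hy => by rw [if_neg hy, zero_smul])
      (fun h0 => absurd (Finset.mem_univ x₀) h0), if_pos rfl, one_smul]
  rw [hX]
  exact Submodule.sum_mem _ fun k _ => Submodule.smul_mem _ _ (Submodule.subset_span ⟨k, rfl⟩)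

/-- **One extra generator**: if at most five linear forms `ℓ₁ k` span all `x_{i,j}` (`j < 4`), then
every `ℓ₁ k` lies in the span of `x_{i,0}, …, x_{i,3}` and one further linear form `ℓ`
(`ℓ = 0` allowed). [folklore] -/
theorem exists_extra_generator {K : Type*} [Field K] (i : Fin 4) {a : ℕ} (ha : a ≤ 5)
    (ℓ₁ : Fin a → MvPolynomial (Fin 4 × Fin 4) K) (hlin : ∀ k, (ℓ₁ k).IsHomogeneous 1)
    (hX : ∀ j, (X (i, j) : MvPolynomial (Fin 4 × Fin 4) K) ∈ Submodule.span K (Set.range ℓ₁)) :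
    ∃ ℓ : MvPolynomial (Fin 4 × Fin 4) K, ℓ.IsHomogeneous 1 ∧
      ∀ k, ℓ₁ k ∈ Submodule.span K
        (insert ℓ (Set.range fun j : Fin 4 => (X (i, j) : MvPolynomial (Fin 4 × Fin 4) K))) := by
  classical
  set U : Submodule K (MvPolynomial (Fin 4 × Fin 4) K) :=
    Submodule.span K (Set.range fun j : Fin 4 => (X (i, j) : MvPolynomial (Fin 4 × Fin 4) K)) with hU
  set T : Submodule K (MvPolynomial (Fin 4 × Fin 4) K) := Submodule.span K (Set.range ℓ₁) with hT
  have hUT : U ≤ T := Submodule.span_le.2 (by rintro _ ⟨j, rfl⟩; exact hX j)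
  have hTdim : Module.finrank K T ≤ 5 :=
    (finrank_range_le_card ℓ₁).trans (by rw [Fintype.card_fin]; exact ha)
  have hind : LinearIndependent K (fun j : Fin 4 => (X (i, j) : MvPolynomial (Fin 4 × Fin 4) K)) :=
    (MvPolynomial.linearIndependent_X (Fin 4 × Fin 4) K).comp (fun j => (i, j)) (fun j j' h => (Prod.mk.inj h).2)
  have hUdim : Module.finrank K U = 4 := by
    rw [hU, finrank_span_eq_card hind, Fintype.card_fin]
  by_cases hall : ∀ k, ℓ₁ k ∈ U
  · refine ⟨0, isHomogeneous_zero _ _ _, fun k => ?_⟩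
    exact Submodule.span_mono (Set.subset_insert _ _) (hall k)
  · push Not at hall
    obtain ⟨k₀, hk₀⟩ := hall
    refine ⟨ℓ₁ k₀, hlin k₀, fun k => ?_⟩
    set U' : Submodule K (MvPolynomial (Fin 4 × Fin 4) K) := Submodule.span K
      (insert (ℓ₁ k₀) (Set.range fun j : Fin 4 => (X (i, j) : MvPolynomial (Fin 4 × Fin 4) K)))
      with hU'
    have hUU' : U < U' := by
      refine lt_of_le_of_ne (Submodule.span_mono (Set.subset_insert _ _)) ?_
      intro hEq
      exact hk₀ (hEq ▸ Submodule.subset_span (Set.mem_insert _ _))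
    have hU'T : U' ≤ T := Submodule.span_le.2 (by
      rintro _ (rfl | ⟨j, rfl⟩)
      · exact Submodule.subset_span ⟨k₀, rfl⟩
      · exact hX j)
    haveI : FiniteDimensional K U' := FiniteDimensional.span_of_finite K (Set.toFinite _)
    haveI : FiniteDimensional K T := FiniteDimensional.span_of_finite K (Set.finite_range _)
    have h5 : 5 ≤ Module.finrank K U' := by
      have := Submodule.finrank_lt_finrank_of_lt hUU'
      omega
    have hEq : U' = T :=
      Submodule.eq_of_le_of_finrank_le hU'T (hTdim.trans h5)
    have : ℓ₁ k ∈ T := Submodule.subset_span ⟨k, rfl⟩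
    rw [← hEq] at this
    exact this

end Summit.ValiantsHypothesis.LiftNullstellensatz

end
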